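import Literature.AlgebraicGeometry.Resolution.ThreefoldResolutionDatum
import HarnessLib

/-!
# Cutkosky 2009, proof of Thm. 7.2: the forced chains and the `E⁻`-component step, phase by phase (named facts, procedural form)

Topic: `Literature/AlgebraicGeometry/Resolution`. Per-phase ("procedural") NAMED FACTS, statements
only, transcribing sentences of the PROOF of Theorem 7.2 (p21 L22 – p23 L27) of S. D. Cutkosky,
*Resolution of singularities for 3-folds in positive characteristic*, Amer. J. Math. **131** (2009)
59–127 [Cutkosky2009] (held author version `paper:doi-10-1353-ajm-0-0036`; "pNN Lmm" = page, line
of its text layer), over the vocabulary of `ThreefoldResolutionDatum.lean` (`ResDatum`, `eta`,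
`singR`, `IsPermissible`, `IsTransform`, `Run`, `boundary`, `Eminus`). Standing hypotheses of §7
(p20 L85–88): "`V` is a nonsingular 3-fold (a 3-dimensional variety over an algebraically closed
field `k`) and `R` is a resolution datum on `V` with `r = ν(R) ≥ 1`" — the fields of `ResDatum` plus
`[IsAlgClosed k]`.

The proof of Thm. 7.2 transforms `R = (∅, E, I, V)` in phases (triple points; double curves; the
isolated `η = 2` points; components of `E⁻` inside `Sing_r`; curves of `Sing_r` on a face of `E⁻`;
the isolated `η = 1` points; two-dimensional components; curves of `Sing_r ∖ E`; the remaining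
points). Three of these phases run a FORCED CHAIN of blow-ups whose finiteness print proves by a
local computation, and one is a single asserted step; these four sentences are the facts below, each
in print's granularity (one point / one curve / one component at a time) and with the context print
names at that stage as hypotheses:

* `Cutkosky2009_thm_7_2_eta2_pointChain_finite` (p21 L27–36): at an `η = 2` point `p` of `Sing_r`
  whose double curve `C` is not in `Sing_r`, the chain of point blow-ups following the strict
  transform of `C` over `p` is finite ("`x = x_1 zⁿ, y = y_1 zⁿ`").
* `Cutkosky2009_thm_7_2_Eminus_component_blowup` (p21 L39–41, † asserted without argument): a
  component `F` of `E⁻` inside `Sing_r` is a permissible centre and after blowing it up (the locus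
  over) `F` is no longer contained in `Sing_r` (the weak reading print uses next, L41).
* `Cutkosky2009_thm_7_2_chain6_finite` (p21 L42 – p22 L5): the chain (6) of sections over a curve
  `C ⊆ Sing_r ∩ F`, `F` a face of `E⁻`, is finite (Remark 6.2 to Thm. 6.1 at the generic point of `C`).
* `Cutkosky2009_thm_7_2_offE_pointChain_finite` (p23 L5–18): at a point `p` of a nonsingular curve
  `C ⊆ Sing_r` not contained in `E`, the chain of point blow-ups following the strict transform of `C`
  over `p` leaves the strict transform of (each member of) `E` after finitely many steps
  ("`f ∉ (x, y)`").

Vocabulary (definitions): `Cutkosky2009.Run.strictChain ρ D n` (the iterated strict transform of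
`V(D)` along a run), `Cutkosky2009.Run.IsPointChain ρ p` (the run blows up the closed points `p n`,
`p (n+1) ↦ p n`). PROVED: `Cutkosky2009_thm_7_2_chain6_finite.isEmpty_chain`.

## Faithfulness notes

* Every fact is the `False`-form ("there is no infinite run such that …") of a printed "after a
  finite number of blow ups …" / "for all `i ≫ 0`" about ONE forced chain; the chain is pinned by
  equations on the centres of a `Run` (whose steps are permissible transforms with the `E^±` rule of
  p19 L5–9, so "`p_n ∈ Sing_r`" / "we continue as long as `C_i ⊂ Sing_r`" are automatic). Nothing is
  asserted about other centres, other orders, or simultaneous blow-ups.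
* "`C ⊄ Sing_r(R_2)`" (p21 L36) is rendered in the local form the printed substitution uses,
  `I_p ⊄ (𝓘_{D_1,p} + 𝓘_{D_2,p})^r`; "curves in `Sing_r(R_7) − E_7`" (p23 L5–6) as "`C` is contained
  in no member of `E⁺ + E⁻`", whence print's "`f ∉ (x, y)`".
* NOT typed here (reported to the desk): the context-free principle "no infinite sequence of
  `Sing_r`-curves dominating a fixed curve `C`" — print uses Remark 6.2 only in the two contexts (6)
  and (9) (the latter is `Cutkosky2009_sec8_noInfiniteCurveRun` in
  `ThreefoldResolutionAlgorithms.lean`), and the principle needs "`C` lies in no two-dimensional part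
  of `Sing_r`" (the isolation hypothesis of the proof of Thm. 6.1, p20 L44–45, L57–58), which print
  never states as such; the ∃-phases (p21 L44–46 "by Theorem 6.1", p22 L13–53, p23 L6–9 "by Corollary
  4.4 [C2]") and the single-step assertions on triple points / double curves / two-dimensional
  components (p21 L22–26, p22 L54 – p23 L4) are not in this file.
* AI transcription; AI review is weaker than expert review.
-/

noncomputable section

namespace Literature.AlgebraicGeometry.Resolution

universe u

open CategoryTheory AlgebraicGeometry TopologicalSpace IsLocalRing

/-! ## Vocabulary: strict transforms along a run, point centres with a named point -/

namespace Cutkosky2009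

variable {k : Type u} [Field k]

/-- **The strict transforms `D = D_0, D_1, D_2, …` of a closed subscheme `V(D) ⊆ V_0` along a run**
("the strict transform of the double curve", p21 L28–29; "the strict transform `F_i` of `F` on
`W_i`", p21 L48–49; "the strict transform of `C_1`", p23 L19): `D_{n+1}` is the strict transform
(`strictTransformIdeal`) of `D_n` under the blow-up `V_{n+1} → V_n` of the `n`-th centre.
[cite: Cutkosky2009, proof of Thm. 7.2 (p. 21 l. 28–29, l. 48–49; p. 23 l. 19)] -/
def Run.strictChain (ρ : Run k) (D : (ρ.datum 0).V.IdealSheafData) : (n : ℕ) → (ρ.datum n).V.IdealSheafData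
  | 0 => D
  | n + 1 => strictTransformIdeal (ρ.map n) (ρ.centre n) (Run.strictChain ρ D n)

/-- Stage `0` of the strict-transform chain is `D` itself. [cite: Cutkosky2009, proof of Thm. 7.2 (p. 21 l. 48–49)] -/
@[simp] theorem Run.strictChain_zero (ρ : Run k) (D : (ρ.datum 0).V.IdealSheafData) :
    ρ.strictChain D 0 = D := rfl

/-- Stage `n+1` of the strict-transform chain is the strict transform of stage `n`. [cite: Cutkosky2009, proof of Thm. 7.2 (p. 21 l. 48–49)] -/
@[simp] theorem Run.strictChain_succ (ρ : Run k) (D : (ρ.datum 0).V.IdealSheafData) (n : ℕ) :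
    ρ.strictChain D (n + 1) = strictTransformIdeal (ρ.map n) (ρ.centre n) (ρ.strictChain D n) := rfl

/-- **The run blows up, at stage `n`, the closed point `p n`, and `p (n+1)` lies over `p n`**
("blow ups of points … centered at the point … which dominates `p`", p21 L28–29; "`p_1 ∈ ψ_2⁻¹(p)`",
p23 L12–13): every centre is supported at the single closed point `p n` (with `IsPermissible` this
makes the centre the reduced point), and the blow-up maps `p (n+1)` to `p n`.
[cite: Cutkosky2009, proof of Thm. 7.2 (p. 21 l. 28–29; p. 23 l. 12–13)] -/
def Run.IsPointChain (ρ : Run k) (p : ∀ n, (ρ.datum n).V) : Prop :=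
  ∀ n, IsClosed ({p n} : Set (ρ.datum n).V) ∧ ((ρ.centre n).support : Set (ρ.datum n).V) = {p n} ∧
    (ρ.map n).base (p (n + 1)) = p n

end Cutkosky2009

/-! ## Thm. 7.2, conclusion 1: the forced chain at an `η = 2` point (p21 L27–36) -/

/-- NAMED FACT — **Cutkosky 2009, proof of Thm. 7.2, the chain of point blow-ups at an isolated
`η = 2` point of `Sing_r` is finite** (p21 L27–36): "Suppose that `p ∈ Sing_r(R_2)` is an (isolated)
point with `η(p) = 2`. Then after a finite number of blow ups of points `W_1 → V_2` centered at the
point on the strict transform of the double curve of `E_2` through `p` which dominates `p`, the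
transform `R'_1` of `R` on `W_1` satisfies `η(p_1) < 2` at all points `p_1 ∈ Sing_r(R'_1)` which
dominate `p`. To see this, let `x, y, z` be regular parameters in `𝒪_{V_2,p}` such that `xy = 0` is
a local equation of `E_2⁻` at `p`. Then `x = y = 0` is a local equation of the double curve `C`
through `p`, and after blowing up `n` times `ψ : W_n → V` along the strict transform of `C`, the
local ring on `W_n` of the point `p_n` on the strict transform of `C` which dominates `p` has regular
parameters `x = x_1 zⁿ, y = y_1 zⁿ, z`. Substituting into generators of `(I_2)_p`, we see that
`ν_{p_n}(I'_n) < r` for `n ≫ 0`, since `C ⊄ Sing_r(R_2)`." (Standing: `V` a nonsingular 3-fold over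
an algebraically closed field, p20 L85–88; context of the proof at `V_2`: `η ≤ 2` on `Sing_r`,
p21 L23–26.) Rendered as the non-existence of the infinite forced chain: there is no infinite run of
permissible transforms whose centres are the closed points `p_0 = p, p_1, p_2, …`, `p_{n+1}` the
point over `p_n` on the strict transforms of BOTH components `D_1 ≠ D_2` of `E⁻` through `p`
(i.e. on the strict transform of the double curve `C = D_1 ∩ D_2`), when `η(p) = 2` and
"`C ⊄ Sing_r(R_2)`" — the latter in the local form print's substitution argument uses:
`I_p ⊄ (x, y)^r = (𝓘_{D_1,p} + 𝓘_{D_2,p})^r` (for the regular prime `(x, y)` of `C` at `p` the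
`r`-th symbolic power is `(x, y)^r`, so `I_p ⊆ (x, y)^r` iff `ν_{ζ_C}(I) ≥ r` iff the component of
`C` through `p` lies in `Sing_r`). Each `p_n` lies in `Sing_r(R_n)` because the centres of a run
are permissible. Users take `(h : Cutkosky2009_thm_7_2_eta2_pointChain_finite)`.
[cite: Cutkosky2009, proof of Thm. 7.2 (author version p. 21 l. 27–36)] -/
def Cutkosky2009_thm_7_2_eta2_pointChain_finite : Prop :=
  ∀ (k : Type u) [Field k] [IsAlgClosed k] (ρ : Cutkosky2009.Run k) (p : ∀ n, (ρ.datum n).V)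
    (D₁ D₂ : (ρ.datum 0).V.IdealSheafData),
    (∀ x ∈ (ρ.datum 0).singR, (ρ.datum 0).eta x ≤ 2) →
    D₁ ∈ (ρ.datum 0).Eminus → D₂ ∈ (ρ.datum 0).Eminus → D₁ ≠ D₂ →
    p 0 ∈ (D₁.support : Set (ρ.datum 0).V) → p 0 ∈ (D₂.support : Set (ρ.datum 0).V) →
    (ρ.datum 0).eta (p 0) = 2 →
    ¬ stalkIdeal (ρ.datum 0).ideal (p 0) ≤ (stalkIdeal D₁ (p 0) ⊔ stalkIdeal D₂ (p 0)) ^ (ρ.datum 0).r →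
    ρ.IsPointChain p →
    (∀ n, p (n + 1) ∈ ((ρ.strictChain D₁ (n + 1)).support : Set (ρ.datum (n + 1)).V) ∧
      p (n + 1) ∈ ((ρ.strictChain D₂ (n + 1)).support : Set (ρ.datum (n + 1)).V)) →
    False

/-! ## Thm. 7.2, conclusion 1: components of `E⁻` inside `Sing_r` (p21 L39–41) -/

/-- NAMED FACT — **Cutkosky 2009, proof of Thm. 7.2, blowing up a component of `E⁻` contained in
`Sing_r`** (p21 L39–41, asserted by print WITHOUT ARGUMENT — † no argument in print): "If there is an
irreducible component `F` of `E_3⁻` contained in `Sing_r(R_3)`, then we can blow up `F` by `V_4 → V_3`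
to eliminate `F` from `Sing_r(R_4)`. In this way we reduce to the assumption that no irreducible
components `F` of `E_4⁻` are contained in `Sing_r(R_4)`." (Context of the proof at `V_3`: `η ≤ 1`
on `Sing_r`, p21 L37–38.) Rendered: for an irreducible two-dimensional closed subset `S` of (the
support of) a member of `E⁻` with `S ⊆ Sing_r(R)`, (i) the reduced subscheme on `S` is a permissible
centre ("we can blow up `F`"), and (ii) after the transform along a blow-up `τ` of it, the locus
over `S` (the exceptional divisor, which is `F` again, `τ` being an isomorphism) is NOT contained in
`Sing_r(R')` — the WEAK reading of "to eliminate `F` from `Sing_r(R_4)`", which is all that print uses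
next (L41 "no irreducible components `F` of `E_4⁻` are contained in `Sing_r(R_4)`"). (The pointwise
reading "no point of `Sing_r(R')` lies over `S`" also holds — `I = 𝓘_F^r · (unit)` near `F` since
`ν ≤ r` everywhere and `ν = r` on `F` — but that argument is not in print and is not asserted here.)
Users take `(h : Cutkosky2009_thm_7_2_Eminus_component_blowup)`.
[cite: Cutkosky2009, proof of Thm. 7.2 (author version p. 21 l. 39–41)] -/
def Cutkosky2009_thm_7_2_Eminus_component_blowup : Prop :=
  ∀ (k : Type u) [Field k] [IsAlgClosed k] (R : Cutkosky2009.ResDatum k) (D : R.V.IdealSheafData)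
    (S : Closeds R.V),
    (∀ x ∈ R.singR, R.eta x ≤ 1) →
    D ∈ R.Eminus → (S : Set R.V) ⊆ (D.support : Set R.V) → IsIrreducible (S : Set R.V) →
    topologicalKrullDim S = 2 → (S : Set R.V) ⊆ R.singR →
    R.IsPermissible (AlgebraicGeometry.Scheme.IdealSheafData.vanishingIdeal S) ∧
      ∀ (R' : Cutkosky2009.ResDatum k) (τ : R'.V ⟶ R.V),
        R.IsTransform R' (AlgebraicGeometry.Scheme.IdealSheafData.vanishingIdeal S) τ →
          ¬ (τ.base ⁻¹' (S : Set R.V) ⊆ R'.singR)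

/-! ## Thm. 7.2, conclusion 1: the chain (6) of sections over a curve of `Sing_r` on a face of `E⁻` (p21 L42 – p22 L5) -/

/-- NAMED FACT — **Cutkosky 2009, proof of Thm. 7.2, the chain (6) is finite** (p21 L42 – p22 L5):
"[In this way we reduce to the assumption that no irreducible components `F` of `E_4⁻` are contained
in `Sing_r(R_4)`.] Now suppose that `C` is a curve in `V_4` which is contained in `Sing_r(R_4)`, and
there is an irreducible component `F` of `E_4⁻` containing `C` (so that `η(p) = 1` for all `p ∈ C`).
By blowing up points on the strict transform of `C` we can construct `W_1 → V_4` such that the strict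
transform `C_1` of `C` on `W_1` is nonsingular and intersects `E'_1` transversely (by Theorem 6.1).
Now we construct the sequence of permissible transforms (6) `⋯ → W_n → W_{n−1} → ⋯ → W_2 → W_1`
where each morphism `W_{i+1} → W_i` is the blow up of the section `C_i` over `C_1` on the strict
transform `F_i` of `F` on `W_i` (`F_i` is isomorphic to `F_1` by this morphsim), and we continue as
long as `C_i` is contained in `Sing_r(R'_i)` … Let `ζ` be the generic point of `C` … by taking base
change of the sequence (6) by localization at `ζ`, we obtain a sequence of blow ups of closed points
above `Spec(𝒪_{V_4,ζ})`. Now by Remark 6.2 to Theorem 6.1, we have that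
`γ_i ∉ Sing_r(W_i ×_{V_4} Spec(𝒪_{V_4,ζ}))` for all `i ≫ 0`. … we see that `C_i ⊄ Sing_r(R'_i)` for
all `i ≫ 0`." Rendered at the stage `W_1` (called `R` below; context: `η ≤ 1` on `Sing_r`, no
two-dimensional irreducible part of a member of `E⁻` inside `Sing_r`, `C ⊆ Sing_r ∩ F` an
irreducible curve, nonsingular and transversal to `E`), as the non-existence of the infinite chain
(6): there is no infinite run whose first centre is `C` and whose `(i+1)`-st centre is the section
`F_{i+1} ∩ G_{i+1}` (ideal `𝓘_{F_{i+1}} + 𝓘_{G_{i+1}}`; `F_{i+1}` the strict transform of `F`,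
`G_{i+1} = ` the exceptional divisor of the `i`-th blow-up) — "we continue as long as `C_i` is
contained in `Sing_r`" being automatic, the centres of a run being permissible. PER CURVE, print's
granularity; nothing is asserted about other curves or other orders.
Users take `(h : Cutkosky2009_thm_7_2_chain6_finite)`.
[cite: Cutkosky2009, proof of Thm. 7.2 (author version p. 21 l. 42–53, p. 22 l. 1–5)] -/
def Cutkosky2009_thm_7_2_chain6_finite : Prop :=
  ∀ (k : Type u) [Field k] [IsAlgClosed k] (ρ : Cutkosky2009.Run k) (F : (ρ.datum 0).V.IdealSheafData)
    (C : Closeds (ρ.datum 0).V),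
    (∀ x ∈ (ρ.datum 0).singR, (ρ.datum 0).eta x ≤ 1) →
    (∀ D ∈ (ρ.datum 0).Eminus, ∀ S : Set (ρ.datum 0).V, S ⊆ (D.support : Set (ρ.datum 0).V) →
      IsIrreducible S → topologicalKrullDim S = 2 → ¬ S ⊆ (ρ.datum 0).singR) →
    F ∈ (ρ.datum 0).Eminus → (C : Set (ρ.datum 0).V) ⊆ (F.support : Set (ρ.datum 0).V) →
    (C : Set (ρ.datum 0).V) ⊆ (ρ.datum 0).singR → IsIrreducible (C : Set (ρ.datum 0).V) →
    topologicalKrullDim C = 1 →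
    Scheme.IsRegular (AlgebraicGeometry.Scheme.IdealSheafData.vanishingIdeal C).subscheme →
    HasSNCWith (ρ.datum 0).boundary (AlgebraicGeometry.Scheme.IdealSheafData.vanishingIdeal C) →
    ρ.centre 0 = AlgebraicGeometry.Scheme.IdealSheafData.vanishingIdeal C →
    (∀ i, ρ.centre (i + 1) = ρ.strictChain F (i + 1) ⊔ (ρ.centre i).comap (ρ.map i)) →
    False

/-! ## Thm. 7.2, conclusion 2: the forced chain at a point where `E` is not transversal to a curve of `Sing_r ∖ E` (p23 L5–18) -/

/-- NAMED FACT — **Cutkosky 2009, proof of Thm. 7.2, the chain of point blow-ups separating a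
nonsingular curve of `Sing_r ∖ E` from `E` is finite** (p23 L5–18): "Suppose that `C_1, …, C_n` are
the Zariski closures in `V_7` of the irreducible curves in `Sing_r(R_7) − E_7`. There exists (by
Corollary 4.4 [C2]) a sequence of blow ups of points `ψ_1 : W_1 → V_7` … such that the strict
transforms `C'_1, …, C'_n` … are nonsingular and disjoint. Suppose that `p ∈ W_1` is such that `E'_1`
is not transversal to `C'_1` (necessarily `p ∉ (E'_1)⁻`). There exist regular parameters `x, y, z` in
`𝒪_{W_1,p}` such that `x = y = 0` are local equations of `C'_1` at `p`. Let `f(x, y, z) = 0` be a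
local equation of `E'_1 = (E'_1)⁺ + (E'_1)⁻` at `p` in `𝒪̂_{W_1,p}`. We necessarily have that
`f ∉ (x, y)𝒪̂_{W_1,p}`. Let `ψ_2 : W_2 → W_1` be the blow up of `p`, and suppose that
`p_1 ∈ ψ_2⁻¹(p)` is on the strict transform of `C'_1`. Then … `x = x_1 z_1, y = y_1 z_1, z = z_1`.
Since `f ∉ (x, y)`, we see by substituting `x = x_n z_nⁿ, y = y_n z_nⁿ, z = z_n` into `f(x, y, z)`,
that after finitely many blow ups of points `W_{n+1} → W_1`, the strict transform of `C_1` is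
disjoint from the strict transform of `E'_1`." Rendered at the stage `W_1` (called `R`; `C` a
nonsingular irreducible closed curve inside `Sing_r`, contained in no member of `E` — "curves in
`Sing_r − E`", whence `f ∉ (x, y)`), as the non-existence of the infinite forced chain: there is no
infinite run of point blow-ups `p_0 = p, p_1, …` with `p_{n+1}` the point over `p_n` on the strict
transform of `C`, every `p_n` lying on the strict transform of one fixed member `D` of `E` through
`p`. Users take `(h : Cutkosky2009_thm_7_2_offE_pointChain_finite)`.
[cite: Cutkosky2009, proof of Thm. 7.2 (author version p. 23 l. 5–18)] -/
def Cutkosky2009_thm_7_2_offE_pointChain_finite : Prop :=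
  ∀ (k : Type u) [Field k] [IsAlgClosed k] (ρ : Cutkosky2009.Run k) (p : ∀ n, (ρ.datum n).V)
    (C : Closeds (ρ.datum 0).V) (D : (ρ.datum 0).V.IdealSheafData),
    (C : Set (ρ.datum 0).V) ⊆ (ρ.datum 0).singR → IsIrreducible (C : Set (ρ.datum 0).V) →
    topologicalKrullDim C = 1 →
    Scheme.IsRegular (AlgebraicGeometry.Scheme.IdealSheafData.vanishingIdeal C).subscheme →
    (∀ D' ∈ (ρ.datum 0).boundary, ¬ (C : Set (ρ.datum 0).V) ⊆ (D'.support : Set (ρ.datum 0).V)) →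
    D ∈ (ρ.datum 0).boundary → p 0 ∈ (C : Set (ρ.datum 0).V) →
    ρ.IsPointChain p →
    (∀ n, p (n + 1) ∈ ((ρ.strictChain (AlgebraicGeometry.Scheme.IdealSheafData.vanishingIdeal C)
      (n + 1)).support : Set (ρ.datum (n + 1)).V)) →
    (∀ n, p n ∈ ((ρ.strictChain D n).support : Set (ρ.datum n).V)) →
    False

/-! ## Proved consequences (IsEmpty forms) -/

namespace Cutkosky2009_thm_7_2_chain6_finite

variable {k : Type u} [Field k] [IsAlgClosed k]

/-- **`IsEmpty` form of the finiteness of the chain (6)**: for the data of print's paragraph at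
`W_1` there is no infinite run realising (6). [cite: Cutkosky2009, proof of Thm. 7.2 (p. 21 l. 46 – p. 22 l. 5)] -/
theorem isEmpty_chain (h : Cutkosky2009_thm_7_2_chain6_finite.{u}) (R : Cutkosky2009.ResDatum k)
    (F : R.V.IdealSheafData) (C : Closeds R.V)
    (hη : ∀ x ∈ R.singR, R.eta x ≤ 1)
    (hE : ∀ D ∈ R.Eminus, ∀ S : Set R.V, S ⊆ (D.support : Set R.V) → IsIrreducible S →
      topologicalKrullDim S = 2 → ¬ S ⊆ R.singR)
    (hF : F ∈ R.Eminus) (hCF : (C : Set R.V) ⊆ (F.support : Set R.V)) (hCs : (C : Set R.V) ⊆ R.singR)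
    (hCi : IsIrreducible (C : Set R.V)) (hCd : topologicalKrullDim C = 1)
    (hCr : Scheme.IsRegular (AlgebraicGeometry.Scheme.IdealSheafData.vanishingIdeal C).subscheme)
    (hCt : HasSNCWith R.boundary (AlgebraicGeometry.Scheme.IdealSheafData.vanishingIdeal C)) :
    IsEmpty {ρ : Cutkosky2009.Run k // ∃ e : ρ.datum 0 = R,
      ρ.centre 0 = e ▸ AlgebraicGeometry.Scheme.IdealSheafData.vanishingIdeal C ∧
      ∀ i, ρ.centre (i + 1) = ρ.strictChain (e ▸ F) (i + 1) ⊔ (ρ.centre i).comap (ρ.map i)} := by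
  refine ⟨fun ⟨ρ, e, h0, hs⟩ => ?_⟩
  subst e
  exact h k ρ F C hη hE hF hCF hCs hCi hCd hCr hCt h0 hs

end Cutkosky2009_thm_7_2_chain6_finite

end Literature.AlgebraicGeometry.Resolution

end
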